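import Summits.HodgeConjecture.HodgeConjecture.Theorems.Ring2AbelianAllAndreFibreProductPencils
import Summits.HodgeConjecture.HodgeConjecture.Theorems.Ring2AbelianAllAndreProductPencilsNodes
import HarnessLib

/-!
# Ring 2 · sub-cell AbelianAll (ALL ABELIAN VARIETIES), André axis, part XXXIII-c — THE ANDRÉ-AXIS NODES ARE THEIR RESTRICTIONS
# TO FIBRE SQUARES: (L) `CMFibreAlgebraicLift`, (L∀) `AlgebraicFixedPart`, (4) `CMAnchoredTransport`, (2) `CompactAbelianPencilVHC`,
# (3) `CMPointedPencilVHC` are each FACT-FREE EQUIVALENT to the same statement for the fibre squares `𝒳 ×_S 𝒳 ⟶ S` of compact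
# pencils of abelian varieties, in the UPPER HALF of degrees `2d ≤ 2q ≤ 4d` (auxiliary varieties restricted to self-fibre-products)

HONEST FRAMING (page 1, verbatim): **research route, not a corollary; conditional on HC_CM plus one named
minimal statement.** Cell line: research route conditional on HC_CM; not a corollary; Q11.4-sentence-2 already
refuted in dim ≥ 3. Nothing in this file proves a case of the Hodge conjecture for an abelian variety; `HC_CM`, `HC_AV` do
not occur; the reduction item `CMToAbelian` (stmt-16267) is NOT closed; the cell's `B_min` of record (N104) is untouched; NO
node is born: the square forms are FILE-LOCAL NOTATIONS (`LiftSq[]`, `FixedPartSq[]`, `TransportSq[]`, `VHCSq[]`,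
`PointedVHCSq[]`) — the lattice / complex bodies of the nodes (parts XVII-b, IX) written for the pencil
`familyPullback.snd f f ≫ f : 𝒳 ×_S 𝒳 ⟶ S` in degrees `d ≤ q ≤ 2d`, at the CM points of `f`; they are EQUIVALENT FORMS, not
candidates; nothing is claimed minimal; 0 `def`, 0 `sorry`, no named fact, axioms standard.

## What this part does (brief (ii): "restrict the class of auxiliary varieties … record each version")

Part XXXIII-b: the fibre square `𝒳 ×_S 𝒳 ⟶ S` of a compact pencil `f` of abelian `d`-folds is a compact pencil of abelian
`2d`-folds with the same CM points, and `f` is an `S`-retract of it through the zero section, so (part XXXIII-a) the lift /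
transport statements of the square in degree `2(p + d)` give those of `f` in degree `2p`. Conversely the square is itself a
compact pencil, so every node implies its square form. Degrees `2p > 2d` of `f` are free (`H^{2p}(𝒳_s) = 0`). Hence, all
FACT-FREE and with NO input beyond parts XXXIII-a/b and the lattice forms of parts IX / XVII-b:

* `cmFibreAlgebraicLift_iff_liftSq` — **(L) ⟺ (L)^□**: specialisation surjectivity `Aᵖ(𝒳) ↠ Aᵖ(𝒳_t)^{inv}` at CM fibres of
  all compact pencils in all degrees ⟺ the same for the fibre SQUARES of compact pencils, in the upper half of degrees, at the
  CM points of the underlying pencil ("find the cycle on the `(2d+1)`-fold `𝒳 ×_S 𝒳` lifting an invariant algebraic class of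
  `𝒳_t × 𝒳_t` of degree `2q ≥ 2d`");
* `algebraicFixedPart_iff_fixedPartSq` — **(L∀) ⟺ (L∀)^□**;
* `cmAnchoredTransport_iff_transportSq` — **(4) ⟺ (4)^□**; `compactAbelianPencilVHC_iff_vhcSq` — **(2) ⟺ (2)^□**;
  `cmPointedPencilVHC_iff_pointedVHCSq` — **(3) ⟺ (3)^□**;
* `nodes_iff_squareNodes` — the five together; `squareNodes_ladder` — the edges of part I among the square forms.

LEVELS (reading). Every `S`-retract padding of codimension `r` (parts XXXII-a, XXXIII-a/b) carries the cell `(d, p)` (relative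
dimension, codimension) to `(d + r, p + r)` and so PRESERVES THE LEVEL `k = d - p` — the DIMENSION of the cycles on the fibre:
constant factors `B × 𝒳` (`r = dim B`) move a cell up its level towards the middle `(2k, k)`; fibre squares (`r = d`) carry
`(d, p)` to `(2d, p + d)`, at or above the middle of the square, on the same level. With part XXX-b's Lefschetz reflection
`(d, p) ↦ (d, d - p)` (level `k ↦ d - k`, i.e. `k`-cycles to codimension-`k` cycles, `2p ≤ d`) these are all the moves the
tree has; none raises the level. So the André-axis `B_min` is graded by the dimension `k` of the cycles to be found on CM
fibres — `k ≤ 1` free (parts XXIX–XXX), `k = 2` free modulo the abelian-fourfold facts (part XXXII-c/e), content from `k = 3`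
(3-cycles on abelian sixfolds, the cell `(6, 3)`) — and the squares say the same content may be read on `(2d+1)`-folds
`𝒳 ×_S 𝒳` in degrees `≥ 2d`. Nothing here is a new candidate; N104 untouched.

HABITAT (prose; part XXXIII-b header): fibre PRODUCTS `𝒴 ×_S 𝒳` of two pencils of abelian threefolds with `K`-multiplication of
signatures `(2,1)` / `(1,2)` over a common curve are CM-pointed compact pencils of Weil-type abelian SIXFOLDS whose Hodge–Weil
classes are coupled (`H³ ⊗ H³`), fibrewise Hodge, monodromy-invariant after a connected finite étale base change (the determinant
character has finite order), and generically not divisor-generated — level `3`, cell `(6, 3)`.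

What is NOT claimed: that squares make any instance easier; any pointwise converse for a fixed pencil beyond the displayed
iff's; anything minimal; any case of HC. EDGE LABELS: every row K (kernel, fact-free).

References: Andre1996Motifs (§5.1 p. 25; §6.3 Lemme 6.3.1 p. 31, a) and Remarque 2 p. 33); Milne2020HodgeClassesAV (Prop. 1
p. 7); Abdulali1994FamiliesAV ((1.1) p. 1122, Lemma 6.2 p. 1131); Fulton1998 (Prop. 1.7, Thm. 6.2 (a)); MumfordGIT (Thm. 6.14);
BrosnanFangNiePearlstein2009 (§6 Lemma 48); CharlesSchnell2014Notes (Cor. 11.3.6); vanGeemen1994HodgeAV (§5).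
-/

noncomputable section

set_option linter.dupNamespace false

namespace Summit.HodgeConjecture.HodgeConjecture.Ring2.AbelianAll

open CategoryTheory CategoryTheory.Limits AlgebraicGeometry MonoidalCategory CartesianMonoidalCategory
open Literature.AlgebraicGeometry Literature.AlgebraicGeometry.Motives
open Literature.AlgebraicGeometry.HodgeTheory
open Literature.AlgebraicGeometry.Deligne1982 (cmLocus)
open Summit.HodgeConjecture.HodgeConjecture
open Summit.HodgeConjecture.HodgeConjecture.Theses
open Summit.HodgeConjecture.HodgeConjecture.Ring2.Deform (CompactAbelianPencilVHC)

variable {𝒳 S : SchemeOver ℂ}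

/-! ## §0 The square forms (file-local notations; nothing is defined or asserted) -/

/-- `(L)^□` — the lift node (L) in lattice form for the fibre SQUARES `𝒳 ×_S 𝒳 ⟶ S` of compact pencils of abelian `d`-folds,
in degrees `2d ≤ 2q ≤ 4d`, at the CM points of the underlying pencil (file-local notation). -/
local notation3 (prettyPrint := false) "LiftSq[]" =>
  ∀ ⦃d : ℕ⦄ ⦃𝒳 S : SchemeOver ℂ⦄ (f : 𝒳 ⟶ S), IsCompactAbelianPencil f d → ∀ q : ℕ, d ≤ q → q ≤ 2 * d →
    ∀ t ∈ cmLocus f d,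
      (algebraicClasses (fiberOver (familyPullback.snd f f ≫ f) t) q).comap
          (complexBetti.map (fiberι (familyPullback.snd f f ≫ f) t) (2 * q)).hom ≤
        algebraicClasses (familyPullback f f) q ⊔ LinearMap.ker (complexBetti.map (fiberι (familyPullback.snd f f ≫ f) t) (2 * q)).hom

/-- `(L∀)^□` — the algebraic fixed part in lattice form for fibre squares, degrees `2d ≤ 2q ≤ 4d`, at EVERY point
(file-local notation). -/
local notation3 (prettyPrint := false) "FixedPartSq[]" =>
  ∀ ⦃d : ℕ⦄ ⦃𝒳 S : SchemeOver ℂ⦄ (f : 𝒳 ⟶ S), IsCompactAbelianPencil f d → ∀ q : ℕ, d ≤ q → q ≤ 2 * d →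
    ∀ t : ComplexPoints S,
      (algebraicClasses (fiberOver (familyPullback.snd f f ≫ f) t) q).comap
          (complexBetti.map (fiberι (familyPullback.snd f f ≫ f) t) (2 * q)).hom ≤
        algebraicClasses (familyPullback f f) q ⊔ LinearMap.ker (complexBetti.map (fiberι (familyPullback.snd f f ≫ f) t) (2 * q)).hom

/-- `(4)^□` — CM-anchored transport on complex cohomology for fibre squares, degrees `2d ≤ 2q ≤ 4d`, anchors the CM points of
the underlying pencil (file-local notation). -/
local notation3 (prettyPrint := false) "TransportSq[]" =>
  ∀ ⦃d : ℕ⦄ ⦃𝒳 S : SchemeOver ℂ⦄ (f : 𝒳 ⟶ S), IsCompactAbelianPencil f d → ∀ q : ℕ, d ≤ q → q ≤ 2 * d →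
    ∀ (U : complexBetti (familyPullback f f) (2 * q)), ∀ t ∈ cmLocus f d,
      complexBetti.map (fiberι (familyPullback.snd f f ≫ f) t) (2 * q) U ∈
          algebraicClasses (fiberOver (familyPullback.snd f f ≫ f) t) q →
        ∀ s : ComplexPoints S,
          complexBetti.map (fiberι (familyPullback.snd f f ≫ f) s) (2 * q) U ∈
            algebraicClasses (fiberOver (familyPullback.snd f f ≫ f) s) q

/-- `(2)^□` — deform's `CompactAbelianPencilVHC` on complex cohomology for fibre squares, degrees `2d ≤ 2q ≤ 4d`
(file-local notation). -/
local notation3 (prettyPrint := false) "VHCSq[]" =>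
  ∀ ⦃d : ℕ⦄ ⦃𝒳 S : SchemeOver ℂ⦄ (f : 𝒳 ⟶ S), IsCompactAbelianPencil f d → ∀ q : ℕ, d ≤ q → q ≤ 2 * d →
    ∀ (U : complexBetti (familyPullback f f) (2 * q)),
      (∃ s₀ : ComplexPoints S, complexBetti.map (fiberι (familyPullback.snd f f ≫ f) s₀) (2 * q) U ∈
          algebraicClasses (fiberOver (familyPullback.snd f f ≫ f) s₀) q) →
        ∀ s : ComplexPoints S,
          complexBetti.map (fiberι (familyPullback.snd f f ≫ f) s) (2 * q) U ∈
            algebraicClasses (fiberOver (familyPullback.snd f f ≫ f) s) q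

/-- `(3)^□` — `CMPointedPencilVHC` on complex cohomology for the fibre squares of CM-pointed compact pencils, degrees
`2d ≤ 2q ≤ 4d` (file-local notation). -/
local notation3 (prettyPrint := false) "PointedVHCSq[]" =>
  ∀ ⦃d : ℕ⦄ ⦃𝒳 S : SchemeOver ℂ⦄ (f : 𝒳 ⟶ S), IsCompactAbelianPencil f d → ∀ q : ℕ, d ≤ q → q ≤ 2 * d →
    (cmLocus f d).Nonempty → ∀ (U : complexBetti (familyPullback f f) (2 * q)),
      (∃ s₀ : ComplexPoints S, complexBetti.map (fiberι (familyPullback.snd f f ≫ f) s₀) (2 * q) U ∈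
          algebraicClasses (fiberOver (familyPullback.snd f f ≫ f) s₀) q) →
        ∀ s : ComplexPoints S,
          complexBetti.map (fiberι (familyPullback.snd f f ≫ f) s) (2 * q) U ∈
            algebraicClasses (fiberOver (familyPullback.snd f f ≫ f) s) q

/-! ## §1 The lift nodes (L), (L∀) are their square forms — FACT-FREE -/

/-- **`(L)^□ ⟹ (L)_t(p)`** at a CM point of a compact pencil of abelian `d`-folds, every `p`: for `p ≤ d` descend from the
square in degree `2(p + d)` (part XXXIII-b `comap_le_sup_of_square`); `p > d` is free. FACT-FREE.
[cite: Fulton1998, Prop. 1.7 and Thm. 6.2 (a)] [cite: Milne2020HodgeClassesAV, Prop. 1 (p. 7)] -/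
theorem comap_le_sup_of_liftSq (hsq : LiftSq[]) {d : ℕ} {f : 𝒳 ⟶ S} (hf : IsCompactAbelianPencil f d)
    {t : ComplexPoints S} (ht : t ∈ cmLocus f d) (p : ℕ) :
    (algebraicClasses (fiberOver f t) p).comap (complexBetti.map (fiberι f t) (2 * p)).hom ≤
      algebraicClasses 𝒳 p ⊔ LinearMap.ker (complexBetti.map (fiberι f t) (2 * p)).hom := by
  rcases Nat.lt_or_ge d p with hdp | hpd
  · exact comap_le_sup_of_relDim_lt hf t hdp
  · exact comap_le_sup_of_square hf (hsq f hf (p + d) (by omega) (by omega) t ht)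

/-- **(L) ⟺ (L)^□ — `CMFibreAlgebraicLift` IS ITS RESTRICTION TO FIBRE SQUARES** (upper half of degrees, CM points of the
underlying pencil). FACT-FREE. [cite: Milne2020HodgeClassesAV, Prop. 1 (p. 7)] [cite: Andre1996Motifs, §5.1 (p. 25)]
[cite: Fulton1998, Prop. 1.7 and Thm. 6.2 (a)] -/
theorem cmFibreAlgebraicLift_iff_liftSq : CMFibreAlgebraicLift ↔ LiftSq[] :=
  ⟨fun h _ _ _ f hf q _ _ t ht ↦ (cmFibreAlgebraicLift_iff_comap_le_sup.1 h) (familyPullback.snd f f ≫ f)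
      (isCompactAbelianPencil_square hf rfl) q t (mem_cmLocus_square f rfl ht),
    fun h ↦ cmFibreAlgebraicLift_iff_comap_le_sup.2 fun _ _ _ _ hf p _ ht ↦ comap_le_sup_of_liftSq h hf ht p⟩

/-- **`(L∀)^□ ⟹ (L∀)` pointwise.** FACT-FREE. [cite: Milne2020HodgeClassesAV, Prop. 1 (p. 7)] [cite: Fulton1998, Prop. 1.7 and Thm. 6.2 (a)] -/
theorem comap_le_sup_of_fixedPartSq (hsq : FixedPartSq[]) {d : ℕ} {f : 𝒳 ⟶ S} (hf : IsCompactAbelianPencil f d)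
    (t : ComplexPoints S) (p : ℕ) :
    (algebraicClasses (fiberOver f t) p).comap (complexBetti.map (fiberι f t) (2 * p)).hom ≤
      algebraicClasses 𝒳 p ⊔ LinearMap.ker (complexBetti.map (fiberι f t) (2 * p)).hom := by
  rcases Nat.lt_or_ge d p with hdp | hpd
  · exact comap_le_sup_of_relDim_lt hf t hdp
  · exact comap_le_sup_of_square hf (hsq f hf (p + d) (by omega) (by omega) t)

/-- **(L∀) ⟺ (L∀)^□ — `AlgebraicFixedPart` IS ITS RESTRICTION TO FIBRE SQUARES.** FACT-FREE (`⊇` of the lattice identity is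
always true, part XVII-b `algebraicClasses_sup_ker_le_comap`). [cite: Milne2020HodgeClassesAV, Prop. 1 (p. 7)] [cite: Fulton1998, Prop. 1.7 and Thm. 6.2 (a)] -/
theorem algebraicFixedPart_iff_fixedPartSq : AlgebraicFixedPart ↔ FixedPartSq[] :=
  ⟨fun h _ _ _ f hf q _ _ t ↦ ((algebraicFixedPart_iff_comap_eq_sup.1 h) (familyPullback.snd f f ≫ f)
      (isCompactAbelianPencil_square hf rfl) q t).le,
    fun h ↦ algebraicFixedPart_iff_comap_eq_sup.2 fun _ _ _ _ hf p t ↦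
      le_antisymm (comap_le_sup_of_fixedPartSq h hf t p) (algebraicClasses_sup_ker_le_comap hf p t)⟩

/-! ## §2 The transport nodes (4), (2), (3) are their square forms — FACT-FREE -/

/-- **`(4)^□ ⟹` transport out of a CM fibre along `f`, every degree** (classwise; `p > d` is free).
FACT-FREE. [cite: Abdulali1994FamiliesAV, (1.1) (p. 1122)] [cite: Fulton1998, Prop. 1.7 and Thm. 6.2 (a)] -/
theorem map_fiberι_mem_of_transportSq (hsq : TransportSq[]) {d : ℕ} {f : 𝒳 ⟶ S} (hf : IsCompactAbelianPencil f d)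
    {t : ComplexPoints S} (ht : t ∈ cmLocus f d) (p : ℕ) (W : complexBetti 𝒳 (2 * p))
    (hW : complexBetti.map (fiberι f t) (2 * p) W ∈ algebraicClasses (fiberOver f t) p) (s : ComplexPoints S) :
    complexBetti.map (fiberι f s) (2 * p) W ∈ algebraicClasses (fiberOver f s) p := by
  rcases Nat.lt_or_ge d p with hdp | hpd
  · exact comap_le_comap_of_dim_lt hf t s hdp hW
  · exact comap_le_comap_of_square hf (t := t) (s := s) (p := p)
      (fun U hU ↦ hsq f hf (p + d) (by omega) (by omega) U t ht hU s) hW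

/-- **(4) ⟺ (4)^□ — `CMAnchoredTransport` IS ITS RESTRICTION TO FIBRE SQUARES.** FACT-FREE.
[cite: Andre1996Motifs, §6.3 a) (p. 33)] [cite: Abdulali1994FamiliesAV, Lemma 6.2 (p. 1131)] [cite: Fulton1998, Prop. 1.7 and Thm. 6.2 (a)] -/
theorem cmAnchoredTransport_iff_transportSq : CMAnchoredTransport ↔ TransportSq[] :=
  ⟨fun h _ _ _ f hf q _ _ U t ht hU s ↦ (cmAnchoredTransport_iff_complex.1 h) (familyPullback.snd f f ≫ f)
      (isCompactAbelianPencil_square hf rfl) q U t (mem_cmLocus_square f rfl ht) hU s,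
    fun h ↦ cmAnchoredTransport_iff_complex.2 fun _ _ _ _ hf p W _ ht hW s ↦
      map_fiberι_mem_of_transportSq h hf ht p W hW s⟩

/-- **`(2)^□ ⟹` transport from any algebraic fibre along `f`, every degree** (classwise). FACT-FREE.
[cite: Abdulali1994FamiliesAV, (1.1) (p. 1122)] [cite: Fulton1998, Prop. 1.7 and Thm. 6.2 (a)] -/
theorem map_fiberι_mem_of_vhcSq (hsq : VHCSq[]) {d : ℕ} {f : 𝒳 ⟶ S} (hf : IsCompactAbelianPencil f d)
    {s₀ : ComplexPoints S} (p : ℕ) (W : complexBetti 𝒳 (2 * p))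
    (hW : complexBetti.map (fiberι f s₀) (2 * p) W ∈ algebraicClasses (fiberOver f s₀) p) (s : ComplexPoints S) :
    complexBetti.map (fiberι f s) (2 * p) W ∈ algebraicClasses (fiberOver f s) p := by
  rcases Nat.lt_or_ge d p with hdp | hpd
  · exact comap_le_comap_of_dim_lt hf s₀ s hdp hW
  · exact comap_le_comap_of_square hf (t := s₀) (s := s) (p := p)
      (fun U hU ↦ hsq f hf (p + d) (by omega) (by omega) U ⟨s₀, hU⟩ s) hW

/-- **(2) ⟺ (2)^□ — deform's `CompactAbelianPencilVHC` IS ITS RESTRICTION TO FIBRE SQUARES.** FACT-FREE.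
[cite: Andre1996Motifs, §6.3 Remarque 2 (p. 33)] [cite: CharlesSchnell2014Notes, Cor. 11.3.6] [cite: Fulton1998, Prop. 1.7 and Thm. 6.2 (a)] -/
theorem compactAbelianPencilVHC_iff_vhcSq : CompactAbelianPencilVHC ↔ VHCSq[] :=
  ⟨fun h _ _ _ f hf q _ _ U hU s ↦ (compactAbelianPencilVHC_iff_complex.1 h) (familyPullback.snd f f ≫ f)
      (isCompactAbelianPencil_square hf rfl) q U hU s,
    fun h ↦ compactAbelianPencilVHC_iff_complex.2 fun _ _ _ _ hf p W hW s ↦ by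
      obtain ⟨s₀, h₀⟩ := hW
      exact map_fiberι_mem_of_vhcSq h hf p W h₀ s⟩

/-- **(3) ⟺ (3)^□ — `CMPointedPencilVHC` IS ITS RESTRICTION TO FIBRE SQUARES** (a CM point of `f` is a CM point of its
square). FACT-FREE. [cite: Andre1996Motifs, Lemme 6.3.1 (p. 31) and Remarque 2 (p. 33)] [cite: Fulton1998, Prop. 1.7 and Thm. 6.2 (a)] -/
theorem cmPointedPencilVHC_iff_pointedVHCSq : CMPointedPencilVHC ↔ PointedVHCSq[] :=
  ⟨fun h _ _ _ f hf q _ _ hne U hU s ↦ by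
      obtain ⟨t₀, ht₀⟩ := hne
      exact (cmPointedPencilVHC_iff_complex.1 h) (familyPullback.snd f f ≫ f) (isCompactAbelianPencil_square hf rfl)
        ⟨t₀, mem_cmLocus_square f rfl ht₀⟩ q U hU s,
    fun h ↦ cmPointedPencilVHC_iff_complex.2 fun _ _ _ _ hf hne p W hW s ↦ by
      obtain ⟨s₀, h₀⟩ := hW
      rcases Nat.lt_or_ge _ p with hdp | hpd
      · exact comap_le_comap_of_dim_lt hf s₀ s hdp h₀
      · exact comap_le_comap_of_square hf (t := s₀) (s := s) (p := p)
          (fun U hU ↦ h _ hf (p + _) (by omega) (by omega) hne U ⟨s₀, hU⟩ s) h₀⟩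

/-! ## §3 The five together, and the reading -/

/-- **THE ANDRÉ-AXIS NODES ARE THEIR RESTRICTIONS TO FIBRE SQUARES**: `((L) ↔ (L)^□) ∧ ((L∀) ↔ (L∀)^□) ∧ ((4) ↔ (4)^□) ∧
((2) ↔ (2)^□) ∧ ((3) ↔ (3)^□)` — the auxiliary varieties of every node of this axis may be restricted to the `(2d+1)`-folds
`𝒳 ×_S 𝒳` (total spaces of the fibre squares of compact pencils of abelian `d`-folds), read in degrees `2d ≤ 2q ≤ 4d`.
FACT-FREE; equivalent forms, not candidates; the cell's `B_min` of record (N104) untouched; nothing claimed minimal.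
[cite: Andre1996Motifs, §6.3 Remarque 2 (p. 33)] [cite: Milne2020HodgeClassesAV, Prop. 1 (p. 7)] [cite: Fulton1998, Prop. 1.7 and Thm. 6.2 (a)] -/
theorem nodes_iff_squareNodes :
    (CMFibreAlgebraicLift ↔ LiftSq[]) ∧ (AlgebraicFixedPart ↔ FixedPartSq[]) ∧ (CMAnchoredTransport ↔ TransportSq[]) ∧
      (CompactAbelianPencilVHC ↔ VHCSq[]) ∧ (CMPointedPencilVHC ↔ PointedVHCSq[]) :=
  ⟨cmFibreAlgebraicLift_iff_liftSq, algebraicFixedPart_iff_fixedPartSq, cmAnchoredTransport_iff_transportSq,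
    compactAbelianPencilVHC_iff_vhcSq, cmPointedPencilVHC_iff_pointedVHCSq⟩

/-- **The square forms imply one another exactly as the nodes do** (part I's edges read through the equivalences):
`(L∀)^□ ⟹ (L)^□ ⟹ (4)^□`, `(2)^□ ⟹ (3)^□ ⟹ (4)^□`, `(L∀)^□ ⟹ (2)^□`. FACT-FREE.
[cite: Andre1996Motifs, §5.1 (p. 25) and §6.3 a) (p. 33)] [cite: Milne2020HodgeClassesAV, Prop. 1 (p. 7)] -/
theorem squareNodes_ladder :
    (FixedPartSq[] → LiftSq[]) ∧ (LiftSq[] → TransportSq[]) ∧ (VHCSq[] → PointedVHCSq[]) ∧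
      (PointedVHCSq[] → TransportSq[]) ∧ (FixedPartSq[] → VHCSq[]) :=
  ⟨fun h ↦ cmFibreAlgebraicLift_iff_liftSq.1
      (cmFibreAlgebraicLift_of_algebraicFixedPart (algebraicFixedPart_iff_fixedPartSq.2 h)),
    fun h ↦ cmAnchoredTransport_iff_transportSq.1
      (cmAnchoredTransport_of_cmFibreAlgebraicLift (cmFibreAlgebraicLift_iff_liftSq.2 h)),
    fun h ↦ cmPointedPencilVHC_iff_pointedVHCSq.1
      (cmPointedPencilVHC_of_compactAbelianPencilVHC (compactAbelianPencilVHC_iff_vhcSq.2 h)),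
    fun h ↦ cmAnchoredTransport_iff_transportSq.1
      (cmAnchoredTransport_of_cmPointedPencilVHC (cmPointedPencilVHC_iff_pointedVHCSq.2 h)),
    fun h ↦ compactAbelianPencilVHC_iff_vhcSq.1
      (compactAbelianPencilVHC_of_algebraicFixedPart (algebraicFixedPart_iff_fixedPartSq.2 h))⟩

end Summit.HodgeConjecture.HodgeConjecture.Ring2.AbelianAll

end
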